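import Literature.Geometry.Lorentzian.NoncompactCauchyFutureSet
import Literature.Geometry.Lorentzian.CausalFutureCompactSet
import HarnessLib

/-!
# No compact set is future-trapped in a globally hyperbolic spacetime with a non-compact Cauchy hypersurface

The causal-theoretic half of Penrose's singularity theorem (Penrose 1965; Hawking–Ellis 1973,
§8.2, Theorem 1, pp. 263–264; O'Neill 1983, Ch. 14, Def. 59, Prop. 60, Theorem 61 and
Corollary A, pp. 435–437). O'Neill, Def. 14.59: a closed achronal set `A` is *future-trapped*
if `E⁺(A) = J⁺(A) ∖ I⁺(A)` is compact; Theorem 14.61: in a spacetime with a Cauchy hypersurface,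
`E⁺(P)` of a future-trapped `P` is itself a Cauchy hypersurface, homeomorphic to the given one,
which is therefore compact (Corollary A). Here, for a time-oriented Lorentzian manifold which is
globally hyperbolic (Bernal–Sánchez form: causal with compact causal diamonds) and has a
non-compact Cauchy hypersurface:

* the tree's `IsGloballyHyperbolic.isClosed_causalFuture_of_isCompact` (**`J⁺(K)` is closed
  for compact `K`**, O'Neill 1983, Ch. 14, Lemma 22 and Exercise 14.4 (b)) and
  `IsChronological.not_subset_chronologicalFuture_of_isCompact` (**a nonempty compact `K` of a
  chronological spacetime is not contained in `I⁺(K)`**), both from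
  `Literature.Geometry.Lorentzian.CausalFutureCompactSet`, give
  `IsChronological.causalFuture_ne_univ`: **`J⁺(K) ≠ M`** (otherwise every point of `K` has a
  point `q ≪ p` in `J⁺(K)`, so `K ⊆ I⁺(K)` by push-up) — this replaces the achronality of `P`
  assumed in O'Neill's Theorem 14.61 and not in Hawking–Ellis's Theorem 1;
* `IsGloballyHyperbolic.not_subset_compact_causalFuture_diff` — **the theorem**: if moreover the
  manifold is connected and `S` is a non-compact Cauchy hypersurface, then for a nonempty compact
  `K` the set `E⁺(K) = J⁺(K) ∖ I⁺(K)` is contained in no compact set. Proof: `F = J⁺(K)` is a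
  closed future set whose frontier lies in `E⁺(K)`; were the latter inside a compact set, the
  frontier would be compact, hence empty
  (`frontier_eq_empty_of_isCompact_of_isCauchyHypersurface`,
  `Literature.Geometry.Lorentzian.NoncompactCauchyFutureSet`), so `J⁺(K) = M`, contradicting the
  previous item.

Everything is proved; no definitions and no named facts are introduced.

## References

* R. Penrose, *Gravitational collapse and space-time singularities*, Phys. Rev. Lett. 14 (1965),
  57–59.
* S. W. Hawking, G. F. R. Ellis, *The large scale structure of space-time*, CUP 1973, §8.2,
  Theorem 1 (pp. 263–264).
* B. O'Neill, *Semi-Riemannian geometry with applications to relativity*, Academic Press 1983,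
  Ch. 14, Lemma 22 (p. 412), Def. 59, Prop. 60, Theorem 61, Corollary A (pp. 435–437),
  Exercise 4 (p. 438).
-/

noncomputable section

open Bundle Set Filter Function
open scoped Manifold ContDiff Topology

namespace Literature.Geometry.Lorentzian

variable {E : Type*} [NormedAddCommGroup E] [NormedSpace ℝ E] {H : Type*} [TopologicalSpace H]
  {I : ModelWithCorners ℝ E H} {n : ℕ∞ω} {M : Type*} [TopologicalSpace M] [ChartedSpace H M]
  [IsManifold I ∞ M]

namespace LorentzianMetric

variable {g : LorentzianMetric I n M} {τ : TimeOrientation g}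

/-! ### `J⁺(K) ≠ M` for compact `K` -/

/-- **In a chronological spacetime `J⁺(K) ≠ M` for a nonempty compact `K`** (finite dimension,
no boundary, `Cⁿ` metric with `n ≥ 1`): otherwise every `p ∈ K` has a point `q ≪ p` in
`J⁺(K)`, so `p ∈ I⁺(K)` by push-up (O'Neill 1983, Ch. 14, Cor. 1), contradicting
`IsChronological.not_subset_chronologicalFuture_of_isCompact`. Consequently `E⁺(K) ≠ ∅` in a
connected such spacetime whenever `J⁺(K)` is closed. O'Neill 1983, Ch. 14, p. 407 and Cor. 1
(p. 402). [cite: ONeillSemiRiemannian1983, Ch. 14, Cor. 1 (p. 402) and p. 407] -/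
theorem IsChronological.causalFuture_ne_univ [FiniteDimensional ℝ E] [BoundarylessManifold I M]
    (hn : 1 ≤ n) (hc : g.IsChronological τ) {K : Set M} (hK : IsCompact K) (hne : K.Nonempty) :
    g.causalFuture τ K ≠ univ := by
  intro hKu
  refine hc.not_subset_chronologicalFuture_of_isCompact hK hne fun p hp ↦ ?_
  obtain ⟨μ, ε, hε, hμ0, hμ⟩ := g.exists_isFutureTimelikeCurveOn_Ioo_of_isInteriorPoint τ
    (BoundarylessManifold.isInteriorPoint (I := I) (x := p))
  have hpq : p ∈ g.chronologicalFuture τ {μ (-(ε / 2))} :=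
    ⟨μ (-(ε / 2)), rfl, μ, -(ε / 2), 0, by linarith,
      hμ.mono (Icc_subset_Ioo (by linarith) hε), rfl, hμ0⟩
  have hqK : μ (-(ε / 2)) ∈ g.causalFuture τ K := hKu ▸ mem_univ _
  rw [causalFuture_eq_biUnion] at hqK
  simp only [mem_iUnion, exists_prop] at hqK
  obtain ⟨k, hkK, hqk⟩ := hqK
  exact chronologicalFuture_mono (singleton_subset_iff.mpr hkK)
    (mem_chronologicalFuture_of_mem_causalFuture hn hqk hpq)

/-! ### The theorem -/

/-- **No nonempty compact set is future-trapped when there is a non-compact Cauchy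
hypersurface** (Penrose 1965; Hawking–Ellis 1973, §8.2, proof of Theorem 1, pp. 263–264:
"`J̇⁺(𝒯)` would be compact … there is clearly going to be trouble if one demands that `ℋ` is
non-compact"; O'Neill 1983, Ch. 14, Theorem 61 and Corollary A, p. 437). On a connected,
Hausdorff, second countable, finite-dimensional manifold without boundary with a `Cⁿ` (`n ≥ 2`)
time-oriented Lorentzian metric which is globally hyperbolic and admits a non-compact Cauchy
hypersurface `S`, for every nonempty compact `K` the set `E⁺(K) = J⁺(K) ∖ I⁺(K)` is contained in
no compact set `C`. Proof: `F = J⁺(K)` is closed (`isClosed_causalFuture_of_isCompact`) with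
`I⁺(F) = I⁺(K) ⊆ F` (push-up), and its frontier lies in `E⁺(K) ⊆ C`, hence is compact, hence
empty (`frontier_eq_empty_of_isCompact_of_isCauchyHypersurface`); so `J⁺(K) = ∅` or `M`, and both
are impossible (`K ≠ ∅`, `IsChronological.causalFuture_ne_univ`). Neither the achronality of `K`
(O'Neill) nor the null completeness / focusing hypotheses enter this half of the theorem.
[cite: HawkingEllis1973CUP, §8.2, Theorem 1 (proof, pp. 263–264)] -/
theorem IsGloballyHyperbolic.not_subset_compact_causalFuture_diff [FiniteDimensional ℝ E]
    [T2Space M] [SecondCountableTopology M] [BoundarylessManifold I M] [ConnectedSpace M]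
    (hn : 2 ≤ n) (hG : g.IsGloballyHyperbolic τ) {S : Set M} (hS : g.IsCauchyHypersurface τ S)
    (hSc : ¬ IsCompact S) {K : Set M} (hK : IsCompact K) (hKne : K.Nonempty) {C : Set M}
    (hC : IsCompact C) (hEC : g.causalFuture τ K \ g.chronologicalFuture τ K ⊆ C) : False := by
  have hn1 : (1 : ℕ∞ω) ≤ n := le_trans one_le_two hn
  set F := g.causalFuture τ K with hFdef
  have hF : IsClosed F := hG.isClosed_causalFuture_of_isCompact hn hK
  have hIK : g.chronologicalFuture τ F = g.chronologicalFuture τ K :=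
    chronologicalFuture_causalFuture_eq_of_boundaryless hn1 K
  have hIF : g.chronologicalFuture τ F ⊆ F :=
    hIK.le.trans (chronologicalFuture_subset_causalFuture g τ K)
  have hint : g.chronologicalFuture τ K ⊆ interior F :=
    interior_maximal (chronologicalFuture_subset_causalFuture g τ K)
      (isOpen_chronologicalFuture_of_boundaryless g τ K)
  have hfr : frontier F ⊆ C := fun x hx ↦ hEC ⟨hF.frontier_subset hx, fun h ↦ hx.2 (hint h)⟩
  have hfrc : IsCompact (frontier F) := hC.of_isClosed_subset isClosed_frontier hfr
  have h0 := frontier_eq_empty_of_isCompact_of_isCauchyHypersurface hn hS hSc hF hIF hfrc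
  rcases frontier_eq_empty_iff.mp h0 with h | h
  · exact hKne.ne_empty (subset_empty_iff.mp (h ▸ subset_causalFuture g τ K))
  · exact hG.isChronological.causalFuture_ne_univ hn1 hK hKne h

end LorentzianMetric

end Literature.Geometry.Lorentzian

end
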